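import Literature.NumberTheory.EllipticCurves.KummerImageIsotropy
import Literature.NumberTheory.EllipticCurves.Isogeny
import Literature.NumberTheory.EllipticCurves.GaloisActionProofs
import Literature.GroupTheory.FiniteAbelian.OrderStatisticsCriterion
import HarnessLib

/-!
# An alternating level pairing on `E[m²]` (`m = 2ᵏ`) is INVARIANT under an additive map of order `3`:
# the determinant lemma `e(F S, F T) = e(S, T)^{det F}`, `det F ≡ 1` (discharge of the binder `he`)

Topic `NumberTheory/EllipticCurves`; namespace `Literature.NumberTheory.EllipticCurves`. THEOREMS ONLY: no
definition, no named fact, no instance, no notation (D-0026, net debt 0). Seat `bsd-cm-k-ty1` (eleventh seating),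
(CT-DEF-6) of `SPEC-K-TY` (planner D607); helper of crux `stmt-BirchSwinnertonDyer-19804` (`UpperOffV0HSYPlus`).
It discharges the displayed input `he : ∀ S T S' T', ↑S' = φ ↑S → ↑T' = φ ↑T → e S' T' = e S T` of
`ctGeneralFun_galH1Map_galH1Map_of_inverse` / `pairing_omegaBalanced_of_weilInvariant`
(`CasselsTateAutomorphismInvariance.lean`, p705246) for `φ` of order `3` (`[ζ]` on a `j = 0` curve), for ANY
bi-additive alternating `μ_{m²}`-valued `e` — in particular the anonymous Weil-type pairings of
`exists_weilPairing_baseChange_compat` — with NO non-degeneracy, NO Galois action and NO Weil-function theory.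
No summit statement is proved or advanced by this file alone; BSD is not claimed.

## THE ARGUMENT (Silverman *AEC* III.6.4(b) `E[N] ≅ (ℤ/N)²`; for the Weil pairing the result is III.8.2 with
`deg φ = 1`)

(§2) `E[N] ≅ ℤ/N × ℤ/N` in characteristic `0`: both sides have exactly `gcd(n, N)²` elements killed by `n` for
every `n ≥ 1` (`#E[g] = g²`, tree `card_torsionBy_eq_sq`; `{x ∈ E[N] : n x = 0} = E[gcd(n, N)]` by Bézout), and a
finite abelian group is determined by these counts (tree `FiniteAbelian.nonempty_addEquiv_of_forall_natCard_nsmul_eq_zero_eq`);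
so `E[N] = ⟨P, Q⟩`. (§1) For an alternating bi-additive `B` and `F P = aP + cQ`, `F Q = bP + dQ`:
`B (iU + jV) (kU + lV) = (il - jk) • B U V`, hence `B (F S) (F T) = (ad - cb) • B S T` (the DETERMINANT); if
`F³ = id` then `(δ³ - 1) • B S T = 0` with `δ = ad - cb`, and when the values are `2`-power torsion the odd factor
`δ² + δ + 1` is invertible on them, so `δ • B S T = B S T`. (§3) Applied to `B = weilPairingHom V (m²) e`
(`KummerImageIsotropy`), `m = 2ᵏ`, and `F = f|E[m²]` for an additive `f : E(K̄) → E(K̄)` with `f³ = id`.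

## WHAT IS FORMALISED

* §1 (`TorsionPairingInvariance.*`, pure algebra, private [folklore] helpers): `zsmul_eq_self_of_pow_three` (the `2`-adic unit step),
  `apply_eq_neg`, `apply_comb_comb`, `apply_map_map_eq_det_zsmul` (determinant), `apply_map_map_eq_of_pow_three`.
* §2 `natCard_nsmul_eq_zero_geomTorsion` (`#{x ∈ E[N] : n x = 0} = gcd(n, N)²`),
  `nonempty_addEquiv_geomTorsion_zmod_prod` (`E[N] ≃+ ℤ/N × ℤ/N`), `exists_two_generators_geomTorsion`.
* §3 ★ `weilPairing_apply_map_map_of_pow_three` (additive `f` with `f³ = id`), ★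
  `weilPairing_apply_isogeny_of_pow_three` (isogeny `φ`, `φ³ = id`: EXACTLY the `he` binder of p705246 at
  `m = 2ᵏ`), `weilPairing_apply_isogeny_of_sq_add_self_add_one` (`φ² + φ + 1 = 0`, the form exported by
  `exists_cm_operator_galH1Torsion`).

## References

* [SilvermanAEC2009] J. H. Silverman, *The Arithmetic of Elliptic Curves*, 2nd ed. (2009), Cor. III.6.4(b)
  (`E[N] ≅ (ℤ/N)²`), Prop. III.8.2 (compatibility of the Weil pairing with isogenies), Thm. III.10.1 (`Aut E`).
* [Hungerford1974] T. W. Hungerford, *Algebra*, Ch. II §2 (torsion counts determine a finite abelian group; tree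
  `FiniteAbelian.OrderStatisticsCriterion`).
-/

noncomputable section

open scoped Classical

universe u

namespace Literature.NumberTheory.EllipticCurves

open _root_.WeierstrassCurve Field Literature.GroupTheory.FiniteAbelian
open Literature.NumberTheory.GaloisRepresentations
open Literature.NumberTheory.GaloisRepresentations.DiscreteGaloisModule (MuCarrier)

namespace TorsionPairingInvariance

/-! ## §1 Algebra: the `2`-adic unit step, the determinant of an alternating form on two generators -/

/-- **The `2`-adic unit step**: if `δ³ • x = x` and `2ʲ • x = 0` then `δ • x = x` (`δ³ - 1 = (δ - 1)(δ² + δ + 1)`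
with `δ² + δ + 1` odd, hence invertible on a `2`-group). [folklore] -/
private theorem zsmul_eq_self_of_pow_three {M : Type*} [AddCommGroup M] {x : M} {δ : ℤ} {j : ℕ}
    (h2 : (2 ^ j : ℤ) • x = 0) (h3 : (δ ^ 3) • x = x) : δ • x = x := by
  obtain ⟨t, ht⟩ := Int.even_mul_succ_self δ
  -- `y = (δ - 1) • x` is killed by the odd number `δ² + δ + 1 = 2t + 1` and by `2ʲ`
  set y : M := (δ - 1) • x with hy
  have hy1 : (2 * t + 1) • y = 0 := by
    have h' : (2 * t + 1) = δ ^ 2 + δ + 1 := by rw [two_mul, ← ht]; ring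
    rw [h', hy, smul_smul, show (δ ^ 2 + δ + 1) * (δ - 1) = δ ^ 3 - 1 by ring, sub_smul, one_smul, h3, sub_self]
  have hy2 : (2 ^ j : ℤ) • y = 0 := by rw [hy, smul_comm, h2, smul_zero]
  have hrec : ∀ n : ℕ, y = ((-(2 * t)) ^ n) • y := by
    intro n
    induction n with
    | zero => rw [pow_zero, one_smul]
    | succ n ih =>
      have h1 : y = (-(2 * t)) • y := by
        rw [neg_smul, eq_neg_iff_add_eq_zero, ← hy1, add_smul, one_smul, add_comm]
      conv_lhs => rw [ih, h1, smul_smul, ← pow_succ]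
  have hy0 : y = 0 := by
    rw [hrec j, show (-(2 * t)) ^ j = (-t) ^ j * (2 : ℤ) ^ j by rw [← mul_pow]; ring, ← smul_smul, hy2,
      smul_zero]
  rw [hy, sub_smul, one_smul, sub_eq_zero] at hy0
  exact hy0

variable {G : Type*} [AddCommGroup G] {M : Type*} [AddCommGroup M] (B : G →+ G →+ M)

/-- An alternating bi-additive form is antisymmetric. [folklore] -/
private theorem apply_eq_neg (halt : ∀ x, B x x = 0) (U V : G) : B V U = -(B U V) := by
  rw [eq_neg_iff_add_eq_zero]
  have h := halt (U + V)
  simp only [map_add, AddMonoidHom.add_apply, halt, zero_add, add_zero] at h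
  exact h

/-- **The value of an alternating form on two combinations of `U, V`**:
`B (iU + jV) (kU + lV) = (il - jk) • B U V`. [folklore] -/
private theorem apply_comb_comb (halt : ∀ x, B x x = 0) (U V : G) (i j k l : ℤ) :
    B (i • U + j • V) (k • U + l • V) = (i * l - j * k) • B U V := by
  have hVU := apply_eq_neg B halt U V
  simp only [map_add, map_zsmul, AddMonoidHom.add_apply, AddMonoidHom.zsmul_apply, halt, hVU, smul_zero,
    zero_add, add_zero, smul_neg, smul_smul]
  module

/-- **The determinant lemma**: if `G` is generated by `P, Q` and `F : G → G` is additive with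
`F P = aP + cQ`, `F Q = bP + dQ`, then `B (F S) (F T) = (ad - cb) • B S T` for every alternating `B`.
[folklore] -/
private theorem apply_map_map_eq_det_zsmul (halt : ∀ x, B x x = 0) {P Q : G} (hgen : ∀ S : G, ∃ i j : ℤ, S = i • P + j • Q)
    (F : G →+ G) {a b c d : ℤ} (hP : F P = a • P + c • Q) (hQ : F Q = b • P + d • Q) (S T : G) :
    B (F S) (F T) = (a * d - c * b) • B S T := by
  obtain ⟨i, j, rfl⟩ := hgen S
  obtain ⟨k, l, rfl⟩ := hgen T
  have hS : F (i • P + j • Q) = i • F P + j • F Q := by rw [map_add, map_zsmul, map_zsmul]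
  have hT : F (k • P + l • Q) = k • F P + l • F Q := by rw [map_add, map_zsmul, map_zsmul]
  rw [hS, hT, apply_comb_comb B halt (F P) (F Q), hP, hQ, apply_comb_comb B halt P Q, apply_comb_comb B halt P Q,
    smul_smul, smul_smul, mul_comm]

/-- **Invariance for a map of order `3` on a `2`-group of values**: with `G = ⟨P, Q⟩`, `F³ = id`, `B`
alternating and `2ʲ • B S T = 0`: `B (F S) (F T) = B S T` (`det³ ≡ 1 ⇒ det ≡ 1`). [folklore] -/
private theorem apply_map_map_eq_of_pow_three (halt : ∀ x, B x x = 0) {P Q : G}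
    (hgen : ∀ S : G, ∃ i j : ℤ, S = i • P + j • Q) (F : G →+ G) (hF3 : ∀ S, F (F (F S)) = S) {j : ℕ}
    (h2 : ∀ S T, (2 ^ j : ℤ) • B S T = 0) (S T : G) : B (F S) (F T) = B S T := by
  obtain ⟨a, c, hP⟩ := hgen (F P)
  obtain ⟨b, d, hQ⟩ := hgen (F Q)
  have hdet := apply_map_map_eq_det_zsmul B halt hgen F hP hQ
  have h3 : ((a * d - c * b) ^ 3) • B S T = B S T := by
    conv_rhs => rw [← hF3 S, ← hF3 T, hdet, hdet, hdet, smul_smul, smul_smul]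
    ring_nf
  rw [hdet]
  exact zsmul_eq_self_of_pow_three (h2 S T) h3

/-! ## §2 `E[N] ≅ ℤ/N × ℤ/N`: two generators of the `N`-torsion -/

variable {K : Type u} [Field K] [CharZero K] (V : WeierstrassCurve K) [V.IsElliptic]

/-- The elements of `E[N]` killed by `n` are exactly `E[gcd(n, N)]`, counted: `#{x ∈ E[N] : n x = 0} = gcd(n, N)²`.
[cite: SilvermanAEC2009, Cor. III.6.4(b)] -/
theorem natCard_nsmul_eq_zero_geomTorsion (N : ℕ) [NeZero N] (n : ℕ) (hn : 0 < n) :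
    Nat.card {x : geomTorsion V (N : ℤ) // n • x = 0} = Nat.gcd n N ^ 2 := by
  have hg0 : Nat.gcd n N ≠ 0 := Nat.gcd_ne_zero_left hn.ne'
  have hgL : ((Nat.gcd n N : ℕ) : AlgebraicClosure K) ≠ 0 := Nat.cast_ne_zero.mpr hg0
  rw [← card_torsionBy_eq_sq (E := V.baseChange (AlgebraicClosure K)) hgL]
  refine Nat.card_congr ⟨fun x => ⟨x.1.1, ?_⟩, fun y => ⟨⟨y.1, ?_⟩, ?_⟩, fun x => rfl, fun y => rfl⟩
  · -- `gcd(n, N) = u n + v N` kills `x`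
    have hx1 : (N : ℤ) • (x.1.1 : V.geomPoints) = 0 := x.1.2
    have hx2 : (n : ℤ) • (x.1.1 : V.geomPoints) = 0 := by
      rw [natCast_zsmul, ← AddSubgroupClass.coe_nsmul, x.2, ZeroMemClass.coe_zero]
    change ((Nat.gcd n N : ℕ) : ℤ) • (x.1.1 : V.geomPoints) = 0
    rw [Nat.gcd_eq_gcd_ab n N, add_smul, mul_comm, mul_smul, hx2, smul_zero, mul_comm, mul_smul, hx1, smul_zero,
      add_zero]
  · -- `E[gcd] ⊆ E[N]`
    have hy : ((Nat.gcd n N : ℕ) : ℤ) • (y.1 : V.geomPoints) = 0 := y.2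
    change (N : ℤ) • (y.1 : V.geomPoints) = 0
    obtain ⟨q, hq⟩ := Nat.gcd_dvd_right n N
    rw [show (N : ℤ) = (q : ℤ) * (Nat.gcd n N : ℕ) by rw [← Nat.cast_mul, mul_comm, ← hq], mul_smul, hy, smul_zero]
  · -- and killed by `n`
    have hy : ((Nat.gcd n N : ℕ) : ℤ) • (y.1 : V.geomPoints) = 0 := y.2
    apply Subtype.ext
    change ((n • (y.1 : V.geomPoints) : V.geomPoints)) = 0
    obtain ⟨q, hq⟩ := Nat.gcd_dvd_left n N
    rw [← natCast_zsmul, show (n : ℤ) = (q : ℤ) * (Nat.gcd n N : ℕ) by rw [← Nat.cast_mul, mul_comm, ← hq], mul_smul,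
      hy, smul_zero]

/-- **`E[N] ≅ ℤ/N × ℤ/N`** for `N ≥ 1` in characteristic `0`: both sides have `gcd(n, N)²` elements killed by
`n` for every `n ≥ 1`, which determines a finite abelian group (tree: `nonempty_addEquiv_of_forall_natCard_nsmul_eq_zero_eq`).
[cite: SilvermanAEC2009, Cor. III.6.4(b)] -/
theorem nonempty_addEquiv_geomTorsion_zmod_prod (N : ℕ) [NeZero N] :
    Nonempty (geomTorsion V (N : ℤ) ≃+ ZMod N × ZMod N) := by
  haveI : Finite (geomTorsion V (N : ℤ)) :=
    finite_torsionPoints_holds V (AlgebraicClosure K) (Int.natCast_ne_zero.mpr (NeZero.ne N))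
  refine nonempty_addEquiv_of_forall_natCard_nsmul_eq_zero_eq _ _ fun n hn => ?_
  rw [natCard_nsmul_eq_zero_geomTorsion V N n hn, natCard_nsmul_eq_zero_prod, natCard_nsmul_eq_zero_zmod, sq]

/-- **Two generators of `E[N]`**: there are `P, Q ∈ E[N]` with every `S ∈ E[N]` of the form `iP + jQ`.
[cite: SilvermanAEC2009, Cor. III.6.4(b)] -/
theorem exists_two_generators_geomTorsion (N : ℕ) [NeZero N] :
    ∃ P Q : geomTorsion V (N : ℤ), ∀ S : geomTorsion V (N : ℤ), ∃ i j : ℤ, S = i • P + j • Q := by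
  obtain ⟨g⟩ := nonempty_addEquiv_geomTorsion_zmod_prod V N
  refine ⟨g.symm (1, 0), g.symm (0, 1), fun S => ⟨((g S).1.val : ℤ), ((g S).2.val : ℤ), g.injective ?_⟩⟩
  rw [map_add, map_zsmul, map_zsmul, g.apply_symm_apply, g.apply_symm_apply]
  refine Prod.ext ?_ ?_
  · rw [Prod.fst_add, Prod.smul_fst, Prod.smul_fst, smul_zero, add_zero, zsmul_eq_mul, mul_one, Int.cast_natCast,
      ZMod.natCast_zmod_val]
  · rw [Prod.snd_add, Prod.smul_snd, Prod.smul_snd, smul_zero, zero_add, zsmul_eq_mul, mul_one, Int.cast_natCast,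
      ZMod.natCast_zmod_val]

end TorsionPairingInvariance

/-! ## §3 The theorem: an alternating pairing on `E[m²]`, `m = 2ᵏ`, is invariant under a map of order `3` -/

section Main

open TorsionPairingInvariance

variable {K : Type u} [Field K] [CharZero K] (V : WeierstrassCurve K) [V.IsElliptic] (m : ℕ) [NeZero m]

/-- **The determinant lemma for an automorphism of order `3` (discharge of the binder `he` of
`ctGeneralFun_galH1Map_galH1Map_of_inverse` / `pairing_omegaBalanced_of_weilInvariant`).** For `E/K` elliptic in
characteristic `0`, `m = 2ᵏ`, ANY bi-additive alternating `μ_{m²}`-valued `e` on `E[m²]` (no non-degeneracy, no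
Galois-equivariance needed — in particular the anonymous Weil-type pairings of `exists_weilPairing_baseChange_compat`),
and ANY additive `f : E(K̄) → E(K̄)` with `f³ = id` (e.g. the automorphism `[ζ]` of a `j = 0` curve, Silverman
*AEC* III.10.1): `e (f S) (f T) = e S T` on `E[m²]`. Proof: `E[m²] = ⟨P, Q⟩ ≅ (ℤ/m²)²` (III.6.4(b)); for an
alternating form `e(f S, f T) = e(S, T)^{det f}` with `det f = ad - bc` read off `f P = aP + cQ`, `f Q = bP + dQ`;
`f³ = id` gives `e^{det³} = e`, and the values being `2`-power torsion while `det² + det + 1` is odd,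
`e^{det} = e` (for the Weil pairing this is III.8.2 with `deg f = 1`). [cite: SilvermanAEC2009, Cor. III.6.4(b), Prop. III.8.2] -/
theorem weilPairing_apply_map_map_of_pow_three {k : ℕ} (hm : m = 2 ^ k)
    (e : geomTorsion V ((m * m : ℕ) : ℤ) → geomTorsion V ((m * m : ℕ) : ℤ) → AlgebraicClosure K)
    (hμ : ∀ S T, e S T ^ (m * m) = 1) (hadd₁ : ∀ S₁ S₂ T, e (S₁ + S₂) T = e S₁ T * e S₂ T)
    (hadd₂ : ∀ S T₁ T₂, e S (T₁ + T₂) = e S T₁ * e S T₂) (halt : ∀ T, e T T = 1)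
    (f : V.geomPoints →+ V.geomPoints) (hf3 : ∀ P, f (f (f P)) = P)
    (S T S' T' : geomTorsion V ((m * m : ℕ) : ℤ)) (hS : (S' : V.geomPoints) = f S) (hT : (T' : V.geomPoints) = f T) :
    e S' T' = e S T := by
  haveI : NeZero (m * m) := ⟨mul_ne_zero (NeZero.ne m) (NeZero.ne m)⟩
  -- `f|E[m²]` as an additive endomorphism `F` of `E[m²]`
  let F : geomTorsion V ((m * m : ℕ) : ℤ) →+ geomTorsion V ((m * m : ℕ) : ℤ) :=
    (f.comp (geomTorsion V ((m * m : ℕ) : ℤ)).subtype).codRestrict _ fun P => by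
      simp only [AddMonoidHom.coe_comp, AddSubgroup.coe_subtype, Function.comp_apply]
      rw [mem_geomTorsion_iff, ← map_zsmul, (mem_geomTorsion_iff _ _ _).mp P.2, map_zero]
  have hS' : S' = F S := Subtype.ext hS
  have hT' : T' = F T := Subtype.ext hT
  have hF3 : ∀ P, F (F (F P)) = P := fun P => Subtype.ext (hf3 P)
  -- the additive alternating form `B = e` with values in `μ_{m²}`, killed by `m² = 2^{2k}`
  let B := weilPairingHom V (m * m) e hμ hadd₁ hadd₂
  have hBalt : ∀ x, B x x = 0 := weilPairingHom_self V (m * m) e hμ hadd₁ hadd₂ halt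
  have hBN : ∀ P Q, (m * m) • B P Q = 0 := fun P Q => by
    rw [muCarrier_eq_iff, map_nsmul, toMul_nsmul, Subgroup.coe_pow, Units.val_pow_eq_pow_val, coe_weilPairingHom, hμ]
    rfl
  have h2 : ∀ P Q, (2 ^ (2 * k) : ℤ) • B P Q = 0 := fun P Q => by
    rw [show (2 : ℤ) ^ (2 * k) = ((m * m : ℕ) : ℤ) by rw [hm]; push_cast; ring, natCast_zsmul, hBN]
  obtain ⟨P₀, Q₀, hgen⟩ := exists_two_generators_geomTorsion V (m * m)
  have key := apply_map_map_eq_of_pow_three B hBalt hgen F hF3 h2 S T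
  rw [muCarrier_eq_iff, coe_weilPairingHom, coe_weilPairingHom] at key
  rw [hS', hT']
  exact key

/-- **The `he` binder of `CasselsTateAutomorphismInvariance` for an isogeny of order `3`** (e.g. `[ζ]` on a
`j = 0` curve, `φ² + φ + 1 = 0` as exported by `exists_cm_operator_galH1Torsion`), `m = 2ᵏ`, any alternating
Weil-type `e` on `E[m²]`. [cite: SilvermanAEC2009, Cor. III.6.4(b), Prop. III.8.2] -/
theorem weilPairing_apply_isogeny_of_pow_three {k : ℕ} (hm : m = 2 ^ k)
    (e : geomTorsion V ((m * m : ℕ) : ℤ) → geomTorsion V ((m * m : ℕ) : ℤ) → AlgebraicClosure K)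
    (hμ : ∀ S T, e S T ^ (m * m) = 1) (hadd₁ : ∀ S₁ S₂ T, e (S₁ + S₂) T = e S₁ T * e S₂ T)
    (hadd₂ : ∀ S T₁ T₂, e S (T₁ + T₂) = e S T₁ * e S T₂) (halt : ∀ T, e T T = 1)
    (φ : Isogeny V V) (hφ3 : ∀ P, φ (φ (φ P)) = P) (S T S' T' : geomTorsion V ((m * m : ℕ) : ℤ))
    (hS : (S' : V.geomPoints) = φ S) (hT : (T' : V.geomPoints) = φ T) : e S' T' = e S T :=
  weilPairing_apply_map_map_of_pow_three V m hm e hμ hadd₁ hadd₂ halt φ.toAddMonoidHom hφ3 S T S' T' hS hT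

/-- Variant with the relation `φ² + φ + 1 = 0` (the form exported by `exists_cm_operator_galH1Torsion` /
`exists_cm_shaMap_relation`) instead of `φ³ = id`. [cite: SilvermanAEC2009, Cor. III.6.4(b), Prop. III.8.2] -/
theorem weilPairing_apply_isogeny_of_sq_add_self_add_one {k : ℕ} (hm : m = 2 ^ k)
    (e : geomTorsion V ((m * m : ℕ) : ℤ) → geomTorsion V ((m * m : ℕ) : ℤ) → AlgebraicClosure K)
    (hμ : ∀ S T, e S T ^ (m * m) = 1) (hadd₁ : ∀ S₁ S₂ T, e (S₁ + S₂) T = e S₁ T * e S₂ T)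
    (hadd₂ : ∀ S T₁ T₂, e S (T₁ + T₂) = e S T₁ * e S T₂) (halt : ∀ T, e T T = 1)
    (φ : Isogeny V V) (hrel : ∀ P, φ (φ P) + φ P + P = 0) (S T S' T' : geomTorsion V ((m * m : ℕ) : ℤ))
    (hS : (S' : V.geomPoints) = φ S) (hT : (T' : V.geomPoints) = φ T) : e S' T' = e S T := by
  refine weilPairing_apply_isogeny_of_pow_three V m hm e hμ hadd₁ hadd₂ halt φ (fun P => ?_) S T S' T' hS hT
  have h1 : φ (φ P) = -(φ P) - P := by rw [← sub_eq_zero]; have := hrel P; abel_nf at this ⊢; exact this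
  rw [h1, map_sub, map_neg, h1]
  abel

end Main

end Literature.NumberTheory.EllipticCurves
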